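import Summits.ValiantsHypothesis.ValiantsHypothesis.Theorems.SuccinctLiftSmlCircuitKit
import Summits.ValiantsHypothesis.ValiantsHypothesis.Theorems.SuccinctLiftSmlProduct

/-!
# SuccinctLift — low product-depth set-multilinearisation over ANY field (circuit conversion)

Support file for wall D of `route-ValiantsHypothesis-SuccinctLift` (stmt-ValiantsHypothesis-23721,
census cell W34 «2-non-unit cut»).  The conversion behind Forbes's theorem (CCC 2024) that the
Limaye–Srinivasan–Tavenas lower bounds hold over every field: a circuit `C` of product depth `Δ`
(unbounded fan-in sum and product gates) computing a polynomial that is set-multilinear over the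
blocks of `blk : σ → Fin d` is converted, gate by gate, into a circuit `H` of product depth `≤ 2Δ`
and size `≤ (edgeSize C + size C) · 2^{O(d log d)}` ALL OF WHOSE GATE VALUES ARE HOMOGENEOUS (indeed
set-multilinear), computing the top set-multilinear part `(C.eval)_{univ}` (`exists_sml_circuit`).
Each member of the simulated family is a set-multilinear part `(value of operand o)_S`,
`S ⊆ Fin d`; a sum gate costs one linear layer, a product gate the four layers of the
characteristic-free expansion `SuccinctLiftSmlProduct.prod_gate_expansion` (product over fibres of a
labelling / class sums / product over fibres / signed sum), so the product depth exactly doubles.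
The homogeneous engine `DepthWindow.homLst_geom_solved` (valid over every field) then applies to `H`
(`SuccinctLiftSmlAnyField*.lean`).  The joint-computation bookkeeping is `SuccinctLiftJointPD`'s,
refined by a gate count and the homogeneity of all gate values (`JointPDH`).

References: Forbes2024LowDepth (CCC 2024, Thm. 1); LimayeSrinivasanTavenas2025 (J. ACM 72, Lemma 12,
Cor. 4); Burgisser2000 (Def. 2.1, Rem. 2.7: the circuit model).
-/

noncomputable section

open MvPolynomial

-- the summit and the problem share the name `ValiantsHypothesis` (D-0017 single-conjunct layout)
set_option linter.dupNamespace false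

namespace Summit.ValiantsHypothesis.ValiantsHypothesis.Theorems.SuccinctLiftSmlCircuit

open Literature.Computability.AlgebraicComplexity ArithCircuit SuccinctLiftJointPD
open SuccinctLiftSmlConvolution SuccinctLiftSmlPlog SuccinctLiftSmlProduct SuccinctLiftSmlCircuitKit

universe u v

/-! ### The gate-by-gate conversion -/

section Conversion

variable {K : Type u} [Field K] {σ : Type v} {d : ℕ} (blk : σ → Fin d)

/-- The per-wire cost unit of the conversion: `γ(d) = 4 · 4^d · d^d · (d + 2)` new wires (and at
most as many new gates) per original wire. [cite: Forbes2024LowDepth, Thm. 1] -/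
def gamma (d : ℕ) : ℕ := 4 * (4 ^ d * d ^ d * (d + 2))

omit [Field K] in
/-- Total fan-in plus gate count, as one sum. [folklore] -/
theorem sum_map_fanIn_succ (G : List (Gate K σ)) :
    (G.map fun g => g.fanIn + 1).sum = (G.map Gate.fanIn).sum + G.length := by
  induction G with
  | nil => simp
  | cons g G ih => simp only [List.map_cons, List.sum_cons, List.length_cons, ih]; omega

/-- The budget of the four layers replacing one product gate of fan-in `m`. [folklore] -/
theorem cost_prod_le (m d : ℕ) :
    m * (2 ^ d * d ^ d) * (d + 1) + 2 ^ d * 2 ^ d * (m * d ^ d + 1) +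
      2 ^ d * (2 ^ d * d ^ d) * (d + 1) + 2 ^ d * (2 ^ d * d ^ d + 1) ≤ (m + 1) * gamma d := by
  have h4 : 2 ^ d * 2 ^ d = 4 ^ d := by rw [← mul_pow]; norm_num
  have h24 : 2 ^ d ≤ 4 ^ d := Nat.pow_le_pow_left (by norm_num) d
  have hE : 1 ≤ d ^ d := by
    rcases Nat.eq_zero_or_pos d with h | h
    · subst h; simp
    · exact Nat.one_le_pow _ _ h
  set E := d ^ d with hEdef
  set B := 4 ^ d with hB
  have hγ : gamma d = 4 * (B * E * (d + 2)) := rfl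
  have hm1 : 1 ≤ m + 1 := by omega
  have T1 : m * (2 ^ d * E) * (d + 1) ≤ (m + 1) * (B * E * (d + 2)) := by
    calc m * (2 ^ d * E) * (d + 1) ≤ (m + 1) * (B * E) * (d + 2) :=
          Nat.mul_le_mul (Nat.mul_le_mul (by omega) (Nat.mul_le_mul_right _ h24)) (by omega)
      _ = (m + 1) * (B * E * (d + 2)) := by ring
  have T2 : 2 ^ d * 2 ^ d * (m * E + 1) ≤ (m + 1) * (B * E * (d + 2)) := by
    rw [h4]
    calc B * (m * E + 1) ≤ B * ((m + 1) * E) := Nat.mul_le_mul_left _ (by nlinarith)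
      _ = (m + 1) * (B * E * 1) := by ring
      _ ≤ (m + 1) * (B * E * (d + 2)) :=
          Nat.mul_le_mul_left _ (Nat.mul_le_mul_left _ (by omega))
  have T3 : 2 ^ d * (2 ^ d * E) * (d + 1) ≤ (m + 1) * (B * E * (d + 2)) := by
    rw [← mul_assoc, h4]
    calc B * E * (d + 1) ≤ B * E * (d + 2) := Nat.mul_le_mul_left _ (by omega)
      _ = 1 * (B * E * (d + 2)) := by ring
      _ ≤ (m + 1) * (B * E * (d + 2)) := Nat.mul_le_mul_right _ hm1
  have T4 : 2 ^ d * (2 ^ d * E + 1) ≤ (m + 1) * (B * E * (d + 2)) := by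
    have h1 : 2 ^ d * (2 ^ d * E + 1) = B * E + 2 ^ d := by rw [mul_add, ← mul_assoc, h4, mul_one]
    rw [h1]
    calc B * E + 2 ^ d ≤ B * E + B * E := by nlinarith
      _ = 1 * (B * E * 2) := by ring
      _ ≤ (m + 1) * (B * E * (d + 2)) :=
          Nat.mul_le_mul hm1 (Nat.mul_le_mul_left _ (by omega))
  rw [hγ]
  calc _ ≤ (m + 1) * (B * E * (d + 2)) + (m + 1) * (B * E * (d + 2)) + (m + 1) * (B * E * (d + 2)) +
        (m + 1) * (B * E * (d + 2)) := add_le_add (add_le_add (add_le_add T1 T2) T3) T4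
    _ = (m + 1) * (4 * (B * E * (d + 2))) := by ring

/-- The budget of the one layer replacing a sum gate of fan-in `m`. [folklore] -/
theorem cost_sum_le (m d : ℕ) : 2 ^ d * (m + 1) ≤ (m + 1) * gamma d := by
  have h24 : 2 ^ d ≤ 4 ^ d := Nat.pow_le_pow_left (by norm_num) d
  have hE : 1 ≤ d ^ d := by
    rcases Nat.eq_zero_or_pos d with h | h
    · subst h; simp
    · exact Nat.one_le_pow _ _ h
  have h1 : 2 ^ d ≤ gamma d := by
    unfold gamma
    calc 2 ^ d ≤ 4 ^ d := h24
      _ = 1 * (4 ^ d * 1 * 1) := by ring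
      _ ≤ 4 * (4 ^ d * d ^ d * (d + 2)) :=
          Nat.mul_le_mul (by norm_num) (Nat.mul_le_mul (Nat.mul_le_mul_left _ hE) (by omega))
  rw [mul_comm]
  exact Nat.mul_le_mul_left _ h1

/-- The value of the constant-`1` member over the empty block set is `1`. [folklore] -/
theorem smlProj_empty_const_one (vals : List (MvPolynomial σ K)) :
    smlProj blk (∅ : Finset (Fin d)) ((Operand.const 1 : Operand K σ).eval vals) = 1 := by
  show smlProj blk ∅ (C 1) = 1
  rw [smlProj_C, if_pos rfl, C_1]

/-- **Sum-gate step.** One linear layer computes the set-multilinear parts of a new sum gate from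
those of its operands (same product depth). [cite: LimayeSrinivasanTavenas2025, Lemma 12] -/
theorem step_sum (vals : List (MvPolynomial σ K)) (deps : List ℕ) (hlen : deps.length = vals.length)
    {s : ℕ} (l : List (K × Operand K σ))
    (h : JointPDH (fun i : Operand K σ × Finset (Fin d) => smlProj blk i.2 (i.1.eval vals))
      (fun i => 2 * i.1.depthIn deps) s) :
    JointPDH (fun i : Operand K σ × Finset (Fin d) =>
        smlProj blk i.2 (i.1.eval (vals ++ [(Gate.sum l).eval vals])))
      (fun i => 2 * i.1.depthIn (deps ++
        [prodWeight (Gate.sum l) + (((Gate.sum l).args.map (Operand.depthIn deps)).foldr max 0)]))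
      (s + (l.length + 1) * gamma d) := by
  classical
  set Dm := ((Gate.sum l).args.map (Operand.depthIn deps)).foldr max 0 with hDm
  have hDm_le : ∀ j : Fin l.length, (l.get j).2.depthIn deps ≤ Dm := fun j =>
    le_foldr_max_of_mem (List.mem_map.2 ⟨(l.get j).2, List.mem_map.2 ⟨l.get j, List.get_mem l j, rfl⟩, rfl⟩)
  have hval : ∀ S : Finset (Fin d), ∑ j : Fin l.length, (l.get j).1 •
      smlProj blk S ((l.get j).2.eval vals) = smlProj blk S ((Gate.sum l).eval vals) := by
    intro S
    rw [eval_sum_eq_sum_univ, map_sum]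
    simp_rw [map_smul]
  have h1 := h.extend_sum (κ := Finset (Fin d)) (J := Fin l.length) (fun _ j => (l.get j).1)
    (fun S j => ((l.get j).2, S)) (2 * Dm) (fun S j => by
      dsimp only; exact Nat.mul_le_mul_left 2 (hDm_le j)) (fun S => by
      dsimp only
      rw [hval S]
      exact ⟨S.card, IsSetMultilinear.isHomogeneous_card blk (isSetMultilinear_smlProj blk S _)⟩)
  refine h1.reindex _ _ ?_ ?_
  · simp only [Fintype.card_finset, Fintype.card_fin]
    have := cost_sum_le l.length d
    omega
  · rintro ⟨o, S⟩
    left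
    by_cases ho : o = Operand.gate vals.length
    · subst ho
      refine ⟨Sum.inr S, ?_, ?_⟩
      · dsimp only
        rw [eval_gate_append_singleton, Sum.elim_inr, hval S]
      · simp only [Sum.elim_inr]
        rw [← hlen, depthIn_gate_append_singleton, prodWeight_sum, zero_add]
    · refine ⟨Sum.inl (o, S), ?_, ?_⟩
      · dsimp only
        rw [eval_append_singleton_of_ne vals _ o ho, Sum.elim_inl]
      · simp only [Sum.elim_inl]
        rw [depthIn_append_singleton_of_ne deps _ o (hlen ▸ ho)]

/-- **Product-gate step** (the heart of the conversion): the four layers of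
`SuccinctLiftSmlProduct.prod_gate_expansion` compute the set-multilinear parts of a new product gate
from those of its operands, doubling the product depth, with set-multilinear (hence homogeneous)
intermediate values. [cite: Forbes2024LowDepth, Thm. 1] [cite: LimayeSrinivasanTavenas2025, Lemma 12] -/
theorem step_prod (vals : List (MvPolynomial σ K)) (deps : List ℕ) (hlen : deps.length = vals.length)
    {s : ℕ} (l : List (Operand K σ))
    (h : JointPDH (fun i : Operand K σ × Finset (Fin d) => smlProj blk i.2 (i.1.eval vals))
      (fun i => 2 * i.1.depthIn deps) s) :
    JointPDH (fun i : Operand K σ × Finset (Fin d) =>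
        smlProj blk i.2 (i.1.eval (vals ++ [(Gate.prod l).eval vals])))
      (fun i => 2 * i.1.depthIn (deps ++
        [prodWeight (Gate.prod l) + (((Gate.prod l).args.map (Operand.depthIn deps)).foldr max 0)]))
      (s + (l.length + 1) * gamma d) := by
  classical
  set m := l.length with hm
  set Dm := ((Gate.prod l).args.map (Operand.depthIn deps)).foldr max 0 with hDm
  have hDm_le : ∀ j : Fin l.length, (l.get j).depthIn deps ≤ Dm := fun j =>
    le_foldr_max_of_mem (List.mem_map.2 ⟨l.get j, List.get_mem l j, rfl⟩)
  set f : Fin l.length → MvPolynomial σ K := fun j => (l.get j).eval vals with hf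
  obtain ⟨a, b, hab⟩ := prod_gate_expansion blk f
  -- the class sums and their set-multilinearity
  set Y : Fin l.length → Finset (Fin d) → (Fin d → Fin d) → MvPolynomial σ K :=
    fun j Q e => labTerm (fun P => smlProj blk P (f j)) Q e with hY
  set Sv : Finset (Fin d) → Finset (Fin d) → MvPolynomial σ K :=
    fun T Q => ∑ y : Fin l.length × (Fin d → Fin d), a T Q y • Y y.1 Q y.2 with hSv
  have hYsml : ∀ j Q e, IsSetMultilinear blk Q (Y j Q e) := fun j Q e =>
    isSetMultilinear_labTerm blk _ (fun P _ => isSetMultilinear_smlProj blk P _) Q e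
  have hSvsml : ∀ T Q, IsSetMultilinear blk Q (Sv T Q) := fun T Q =>
    IsSetMultilinear.sum blk _ fun y _ => (hYsml y.1 Q y.2).smul blk _
  -- the base family and its value / depth functions
  set V0 : Operand K σ × Finset (Fin d) → MvPolynomial σ K := fun i => smlProj blk i.2 (i.1.eval vals)
    with hV0
  set D0 : Operand K σ × Finset (Fin d) → ℕ := fun i => 2 * i.1.depthIn deps with hD0
  -- layer 1: products over the fibres of a labelling of the parts `(f_j)_P`
  set src1 : Fin l.length × Finset (Fin d) × (Fin d → Fin d) → Fin d → Operand K σ × Finset (Fin d) :=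
    fun x l' => if (fib x.2.1 x.2.2 l').Nonempty then (l.get x.1, fib x.2.1 x.2.2 l')
      else (Operand.const 1, ∅) with hsrc1
  have hv1 : ∀ x : Fin l.length × Finset (Fin d) × (Fin d → Fin d),
      ∏ l', V0 (src1 x l') = Y x.1 x.2.1 x.2.2 := by
    intro x
    rw [hY]; dsimp only; rw [labTerm]
    refine Finset.prod_congr rfl fun l' _ => ?_
    rw [hsrc1]; dsimp only
    split_ifs with hne
    · rfl
    · exact smlProj_empty_const_one blk vals
  have h1 := h.extend_prod src1 (2 * Dm) (fun x l' => by
      rw [hsrc1, hD0]; dsimp only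
      split_ifs
      · exact Nat.mul_le_mul_left 2 (hDm_le x.1)
      · simp [Operand.depthIn]) (fun x => by
      rw [hv1]; exact ⟨_, IsSetMultilinear.isHomogeneous_card blk (hYsml x.1 x.2.1 x.2.2)⟩)
  have h1n : JointPDH (Sum.elim V0 (fun x : Fin l.length × Finset (Fin d) × (Fin d → Fin d) =>
      Y x.1 x.2.1 x.2.2)) (Sum.elim D0 (fun _ => 2 * Dm + 1)) _ :=
    h1.reindex _ _ le_rfl (by
      rintro (i | x)
      · exact Or.inl ⟨Sum.inl i, rfl, le_rfl⟩
      · exact Or.inl ⟨Sum.inr x, by rw [Sum.elim_inr, Sum.elim_inr, hv1], le_rfl⟩)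
  -- layer 2: the class sums `Sv T Q`
  have h2 := h1n.extend_sum (κ := Finset (Fin d) × Finset (Fin d)) (J := Fin l.length × (Fin d → Fin d))
    (fun x y => a x.1 x.2 y) (fun x y => Sum.inr (y.1, x.2, y.2)) (2 * Dm + 1)
    (fun x y => by simp) (fun x => by
      simp only [Sum.elim_inr]
      exact ⟨_, IsSetMultilinear.isHomogeneous_card blk (hSvsml x.1 x.2)⟩)
  have h2n : JointPDH (Sum.elim (Sum.elim V0 (fun x : Fin l.length × Finset (Fin d) × (Fin d → Fin d) =>
      Y x.1 x.2.1 x.2.2)) (fun x : Finset (Fin d) × Finset (Fin d) => Sv x.1 x.2))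
      (Sum.elim (Sum.elim D0 (fun _ => 2 * Dm + 1)) (fun _ => 2 * Dm + 1)) _ :=
    h2.reindex _ _ le_rfl (by
      rintro (i | x)
      · exact Or.inl ⟨Sum.inl i, rfl, le_rfl⟩
      · exact Or.inl ⟨Sum.inr x, by simp only [Sum.elim_inr]; rfl, le_rfl⟩)
  -- layer 3: products of class sums over the fibres of a labelling
  set src3 : Finset (Fin d) × Finset (Fin d) × (Fin d → Fin d) → Fin d →
      ((Operand K σ × Finset (Fin d)) ⊕ (Fin l.length × Finset (Fin d) × (Fin d → Fin d))) ⊕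
        (Finset (Fin d) × Finset (Fin d)) :=
    fun x l' => if (fib x.1 x.2.2 l').Nonempty then Sum.inr (x.2.1, fib x.1 x.2.2 l')
      else Sum.inl (Sum.inl (Operand.const 1, ∅)) with hsrc3
  have hv3 : ∀ x : Finset (Fin d) × Finset (Fin d) × (Fin d → Fin d),
      ∏ l', Sum.elim (Sum.elim V0 (fun x : Fin l.length × Finset (Fin d) × (Fin d → Fin d) =>
        Y x.1 x.2.1 x.2.2)) (fun x : Finset (Fin d) × Finset (Fin d) => Sv x.1 x.2) (src3 x l') =
        labTerm (Sv x.2.1) x.1 x.2.2 := by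
    intro x
    rw [labTerm]
    refine Finset.prod_congr rfl fun l' _ => ?_
    rw [hsrc3]; dsimp only
    split_ifs with hne
    · simp only [Sum.elim_inr]
    · simp only [Sum.elim_inl]
      exact smlProj_empty_const_one blk vals
  have hTsml : ∀ S T e, IsSetMultilinear blk S (labTerm (Sv T) S e) := fun S T e =>
    isSetMultilinear_labTerm blk _ (fun P _ => hSvsml T P) S e
  have h3 := h2n.extend_prod src3 (2 * Dm + 1) (fun x l' => by
      rw [hsrc3]; dsimp only
      split_ifs
      · simp
      · simp [hD0, Operand.depthIn]) (fun x => by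
      rw [hv3]; exact ⟨_, IsSetMultilinear.isHomogeneous_card blk (hTsml x.1 x.2.1 x.2.2)⟩)
  have h3n : JointPDH (Sum.elim (Sum.elim (Sum.elim V0
      (fun x : Fin l.length × Finset (Fin d) × (Fin d → Fin d) => Y x.1 x.2.1 x.2.2))
      (fun x : Finset (Fin d) × Finset (Fin d) => Sv x.1 x.2))
      (fun x : Finset (Fin d) × Finset (Fin d) × (Fin d → Fin d) => labTerm (Sv x.2.1) x.1 x.2.2))
      (Sum.elim (Sum.elim (Sum.elim D0 (fun _ => 2 * Dm + 1)) (fun _ => 2 * Dm + 1))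
        (fun _ => 2 * Dm + 1 + 1)) _ :=
    h3.reindex _ _ le_rfl (by
      rintro (i | x)
      · exact Or.inl ⟨Sum.inl i, rfl, le_rfl⟩
      · exact Or.inl ⟨Sum.inr x, by rw [Sum.elim_inr, Sum.elim_inr, hv3], le_rfl⟩)
  -- layer 4: the signed sums giving `(∏_j f_j)_S`
  have hfin : ∀ S : Finset (Fin d), ∑ x : Finset (Fin d) × (Fin d → Fin d),
      b S x • labTerm (Sv x.1) S x.2 = smlProj blk S ((Gate.prod l).eval vals) := by
    intro S
    rw [eval_prod_eq_prod_univ, hab S]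
  have h4 := h3n.extend_sum (κ := Finset (Fin d)) (J := Finset (Fin d) × (Fin d → Fin d))
    (fun S x => b S x) (fun S x => Sum.inr (S, x.1, x.2)) (2 * Dm + 1 + 1) (fun S x => by simp)
    (fun S => by
      simp only [Sum.elim_inr]
      rw [hfin S]
      exact ⟨S.card, IsSetMultilinear.isHomogeneous_card blk (isSetMultilinear_smlProj blk S _)⟩)
  -- read the new family off
  refine h4.reindex _ _ ?_ ?_
  · simp only [Fintype.card_prod, Fintype.card_finset, Fintype.card_fun, Fintype.card_fin]
    have := cost_prod_le l.length d
    rw [hm]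
    omega
  · rintro ⟨o, S⟩
    left
    by_cases ho : o = Operand.gate vals.length
    · subst ho
      refine ⟨Sum.inr S, ?_, ?_⟩
      · dsimp only
        rw [eval_gate_append_singleton, Sum.elim_inr]
        simp only [Sum.elim_inr]
        rw [hfin S]
      · simp only [Sum.elim_inr]
        rw [← hlen, depthIn_gate_append_singleton, prodWeight_prod]
        omega
    · refine ⟨Sum.inl (Sum.inl (Sum.inl (Sum.inl (o, S)))), ?_, ?_⟩
      · dsimp only
        rw [eval_append_singleton_of_ne vals _ o ho]
        simp only [Sum.elim_inl, hV0]
      · simp only [Sum.elim_inl, hD0]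
        rw [depthIn_append_singleton_of_ne deps _ o (hlen ▸ ho)]

/-- **The invariant**: after the first `t` gates of `C`, all set-multilinear parts of all operand
values are jointly computed with homogeneous gate values, doubled product depth and
`γ(d) · ∑_{j<t} (fanIn_j + 1)` wires. [cite: Forbes2024LowDepth, Thm. 1] -/
theorem sml_invariant (P : ArithCircuit K σ) (t : ℕ) (ht : t ≤ P.gates.length) :
    JointPDH (fun i : Operand K σ × Finset (Fin d) =>
        smlProj blk i.2 (i.1.eval (gateValues (P.gates.take t))))
      (fun i => 2 * i.1.depthIn (gateWDepths prodWeight (P.gates.take t)))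
      (((P.gates.take t).map fun g => g.fanIn + 1).sum * gamma d) := by
  classical
  induction t with
  | zero =>
    rw [List.take_zero]
    refine jointPDH_of_inputs _ _ _ ?_
    rintro ⟨o, S⟩
    dsimp only
    cases o with
    | var x =>
      rw [show (Operand.var x : Operand K σ).eval (gateValues []) = X x from rfl, smlProj_X]
      split_ifs
      · exact Or.inl ⟨x, rfl⟩
      · exact Or.inr ⟨0, by rw [C_0]⟩
    | const c =>
      rw [show (Operand.const c : Operand K σ).eval (gateValues []) = C c from rfl, smlProj_C]
      split_ifs
      · exact Or.inr ⟨c, rfl⟩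
      · exact Or.inr ⟨0, by rw [C_0]⟩
    | gate j =>
      refine Or.inr ⟨0, ?_⟩
      rw [show (Operand.gate j : Operand K σ).eval (gateValues []) = 0 by
        simp [Operand.eval, gateValues], map_zero, C_0]
  | succ t ih =>
    have ht' : t < P.gates.length := ht
    have h := ih ht'.le
    have htake : P.gates.take (t + 1) = P.gates.take t ++ [P.gates[t]] :=
      List.take_succ_eq_append_getElem ht'
    have hlen : (gateWDepths prodWeight (P.gates.take t)).length =
        (gateValues (P.gates.take t)).length := by
      rw [gateWDepths_length, gateValues_length]
    rw [htake, gateValues_append_singleton, gateWDepths_append_singleton, List.map_append,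
      List.sum_append, List.map_singleton, List.sum_singleton, add_mul]
    cases hg : P.gates[t] with
    | sum l =>
      have := step_sum blk _ _ hlen l h
      simpa [Gate.fanIn, Gate.args] using this
    | prod l =>
      have := step_prod blk _ _ hlen l h
      simpa [Gate.fanIn, Gate.args] using this

/-- **Low product-depth set-multilinearisation over any field** (Forbes 2024; LST 2025, Lemma 12 in
characteristic `0`): for every circuit `C` over ANY field and every block map `blk : σ → Fin d`
there is a circuit `H` computing the top set-multilinear part `(P.eval)_{Fin d}` ALL OF WHOSE GATE
VALUES ARE HOMOGENEOUS, with `productDepth H ≤ 2 · productDepth C` and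
`size H, edgeSize H ≤ (edgeSize C + size C) · γ(d)`, `γ(d) = 4 · 4^d · d^d · (d+2) = 2^{O(d log d)}`.
[cite: Forbes2024LowDepth, Thm. 1] [cite: LimayeSrinivasanTavenas2025, Lemma 12] -/
theorem exists_sml_circuit (P : ArithCircuit K σ) :
    ∃ H : ArithCircuit K σ, H.Computes (smlProj blk Finset.univ P.eval) ∧
      (∀ w ∈ gateValues H.gates, ∃ e : ℕ, w.IsHomogeneous e) ∧
      H.productDepth ≤ 2 * P.productDepth ∧ H.size ≤ (P.edgeSize + P.size) * gamma d ∧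
      H.edgeSize ≤ (P.edgeSize + P.size) * gamma d := by
  have h := sml_invariant blk P P.gates.length le_rfl
  rw [List.take_length, sum_map_fanIn_succ] at h
  obtain ⟨H, hH, hhom, hpd, hsize, hedge⟩ := h.toCircuit (P.output, Finset.univ)
  exact ⟨H, hH, hhom, hpd, hsize, hedge⟩

end Conversion

end Summit.ValiantsHypothesis.ValiantsHypothesis.Theorems.SuccinctLiftSmlCircuit
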